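import Literature.Analysis.Calculus.CoordinateJets
import HarnessLib

/-!
# The total derivative of a jet functional along a basis direction

Continuation of `Literature/Analysis/Calculus/CoordinateJets.lean` (calculus layer of the
a-priori bootstrap of Gilbarg–Trudinger 2001, Lemma 17.16, for
`Literature.Geometry.Riemannian.gurskyViaclovsky_pathClosed_weighted_four`; everything proved, no
named facts).

For a function `G` of `(y, θ, J) ∈ E × P × CJet ι m` (point, parameters, coordinate `m`-jet) and
a basis direction `e_{i₀}`, the **total derivative** `TD bE m i₀ G` is the function of
`(y, θ, J') ∈ E × P × CJet ι (m+1)` given by `DG(y, θ, trunc J') · (e_{i₀}, 0, ins i₀ J')`.  Along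
the coordinate jets of a `C^{m+1}` function `u` this is the chain rule
`∂_{e_{i₀}} [G(y, θ, cjet_m u(y))] = (TD i₀ G)(y, θ, cjet_{m+1} u(y))` (`fderiv_comp_cjetOf`), so
an equation `G(y, θ, cjet_m u (y)) = 0` on an open set differentiates to
`(TD i₀ G)(y, θ, cjet_{m+1} u(y)) = 0` (`TD_comp_cjetOf_eq_zero`).  `TD i₀ G` is `C^∞` where `G`
is (`contDiffOn_TD`), its derivative in the new top jet slot is the derivative of `G` in its own
top slot composed with `Ω ↦ (I ↦ Ω (snoc I i₀))` (`fderiv_TD_single_last`: the principal symbol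
is inherited), and `TD_eq_symbol_add` splits `TD i₀ G (y, θ, J')` into this top-order part applied
to the top slot of `J'` plus a remainder depending only on the lower slots — the quasilinear
structure of the differentiated equation used in the bootstrap.

## References

* D. Gilbarg, N. S. Trudinger, *Elliptic Partial Differential Equations of Second Order*,
  Classics in Mathematics, Springer 2001, Lemma 17.16. [GilbargTrudinger2001]
-/

noncomputable section

open scoped ContDiff Topology
open Set Function

namespace Literature.Analysis.Calculus

variable {ι : Type*} [Fintype ι] {E : Type*} [NormedAddCommGroup E] [InnerProductSpace ℝ E]
variable {P : Type*} [NormedAddCommGroup P] [NormedSpace ℝ P]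

/-- **Total derivative along the basis direction `e_{i₀}`** of a function of `(y, θ, m-jet)`:
the function of `(y, θ, (m+1)-jet)` given by `DG(y, θ, J_{≤ m}) · (e_{i₀}, 0, ins i₀ J)`; along
the coordinate jets of a smooth `u` it is `∂_{e_{i₀}} [G(y, θ, cjet_m u(y))]`
(`fderiv_comp_cjetOf`). [folklore] -/
def TD (bE : OrthonormalBasis ι ℝ E) (m : ℕ) (i₀ : ι) (G : E × P × CJet ι m → ℝ) :
    E × P × CJet ι (m + 1) → ℝ := fun x =>
  fderiv ℝ G (x.1, x.2.1, CJet.trunc ι m x.2.2) (bE i₀, 0, CJet.ins ι m i₀ x.2.2)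

/-- **Chain rule**: `∂_{e_{i₀}} [G(y, θ, cjet_m u(y))] = (TD i₀ G)(y, θ, cjet_{m+1} u(y))`.
[folklore] -/
theorem fderiv_comp_cjetOf (bE : OrthonormalBasis ι ℝ E) {m : ℕ} {G : E × P × CJet ι m → ℝ}
    {u : E → ℝ} {y : E} (θ : P) (hG : DifferentiableAt ℝ G (y, θ, cjetOf bE m u y))
    (hu : ContDiffAt ℝ (m + 1 : ℕ) u y) (i₀ : ι) :
    fderiv ℝ (fun z => G (z, θ, cjetOf bE m u z)) y (bE i₀) =
      TD bE m i₀ G (y, θ, cjetOf bE (m + 1) u y) := by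
  obtain ⟨hd, hdir⟩ := hasFDerivAt_cjetOf_apply bE hu
  have hφ : HasFDerivAt (fun z => (z, θ, cjetOf bE m u z))
      ((ContinuousLinearMap.id ℝ E).prod
        ((0 : E →L[ℝ] P).prod (fderiv ℝ (cjetOf bE m u) y))) y :=
    (hasFDerivAt_id y).prodMk ((hasFDerivAt_const θ y).prodMk hd.hasFDerivAt)
  have hc : HasFDerivAt (fun z => G (z, θ, cjetOf bE m u z))
      ((fderiv ℝ G (y, θ, cjetOf bE m u y)).comp ((ContinuousLinearMap.id ℝ E).prod
        ((0 : E →L[ℝ] P).prod (fderiv ℝ (cjetOf bE m u) y)))) y :=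
    hG.hasFDerivAt.comp y hφ
  rw [hc.fderiv, ContinuousLinearMap.comp_apply, ContinuousLinearMap.prod_apply,
    ContinuousLinearMap.prod_apply, hdir]
  rfl

/-- **Vanishing propagates**: if `G(y, θ, cjet_m u(y)) = 0` on an open set, then
`(TD i₀ G)(y, θ, cjet_{m+1} u(y)) = 0` there. [folklore] -/
theorem TD_comp_cjetOf_eq_zero (bE : OrthonormalBasis ι ℝ E) {m : ℕ} {G : E × P × CJet ι m → ℝ}
    {u : E → ℝ} {O : Set E} (hO : IsOpen O) (θ : P)
    (hG : ∀ y ∈ O, DifferentiableAt ℝ G (y, θ, cjetOf bE m u y))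
    (hu : ContDiffOn ℝ (m + 1 : ℕ) u O) (h0 : ∀ y ∈ O, G (y, θ, cjetOf bE m u y) = 0) (i₀ : ι) :
    ∀ y ∈ O, TD bE m i₀ G (y, θ, cjetOf bE (m + 1) u y) = 0 := by
  intro y hy
  rw [← fderiv_comp_cjetOf bE θ (hG y hy) (hu.contDiffAt (hO.mem_nhds hy)) i₀]
  have hev : (fun z => G (z, θ, cjetOf bE m u z)) =ᶠ[𝓝 y] fun _ => (0 : ℝ) :=
    Filter.eventually_of_mem (hO.mem_nhds hy) fun z hz => h0 z hz
  rw [hev.fderiv_eq]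
  simp

/-- **Smoothness**: `TD i₀ G` is `C^∞` where `G` is, over an open set of `(y, θ)`. [folklore] -/
theorem contDiffOn_TD (bE : OrthonormalBasis ι ℝ E) {m : ℕ} {G : E × P × CJet ι m → ℝ}
    {s : Set (E × P)} (hs : IsOpen s) (hG : ContDiffOn ℝ ∞ G {x | (x.1, x.2.1) ∈ s}) (i₀ : ι) :
    ContDiffOn ℝ ∞ (TD bE m i₀ G) {x | (x.1, x.2.1) ∈ s} := by
  have ht : IsOpen {x : E × P × CJet ι m | (x.1, x.2.1) ∈ s} :=
    hs.preimage (continuous_fst.prodMk (continuous_fst.comp continuous_snd))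
  let A : (E × P × CJet ι (m + 1)) →L[ℝ] (E × P × CJet ι m) :=
    (ContinuousLinearMap.fst ℝ E (P × CJet ι (m + 1))).prod
      (((ContinuousLinearMap.fst ℝ P (CJet ι (m + 1))).comp
        (ContinuousLinearMap.snd ℝ E (P × CJet ι (m + 1)))).prod
        ((CJet.trunc ι m).comp ((ContinuousLinearMap.snd ℝ P (CJet ι (m + 1))).comp
          (ContinuousLinearMap.snd ℝ E (P × CJet ι (m + 1))))))
  have h1 : ContDiffOn ℝ ∞ (fun x : E × P × CJet ι (m + 1) =>
      fderiv ℝ G (x.1, x.2.1, CJet.trunc ι m x.2.2)) {x | (x.1, x.2.1) ∈ s} :=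
    (hG.fderiv_of_isOpen ht (le_of_eq rfl)).comp A.contDiff.contDiffOn fun x hx => hx
  have h2 : ContDiff ℝ ∞ (fun x : E × P × CJet ι (m + 1) =>
      ((bE i₀ : E), (0 : P), CJet.ins ι m i₀ x.2.2)) :=
    contDiff_const.prodMk (contDiff_const.prodMk
      ((CJet.ins ι m i₀).contDiff.comp (contDiff_snd.comp contDiff_snd)))
  exact h1.clm_apply h2.contDiffOn

/-- **The top-order symbol is inherited**: the derivative of `TD i₀ G` in the top jet slot, in
direction `Ω`, is the derivative of `G` in ITS top slot in direction `I ↦ Ω(I, i₀)`. [folklore] -/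
theorem fderiv_TD_single_last (bE : OrthonormalBasis ι ℝ E) [DecidableEq ι] {m : ℕ}
    {G : E × P × CJet ι m → ℝ} {s : Set (E × P)} (hs : IsOpen s)
    (hG : ContDiffOn ℝ ∞ G {x | (x.1, x.2.1) ∈ s}) (i₀ : ι) {y : E} {θ : P} (hy : (y, θ) ∈ s)
    (J : CJet ι (m + 1)) (Ω : (Fin (m + 1) → ι) → ℝ) :
    fderiv ℝ (TD bE m i₀ G) (y, θ, J) ((0 : E), (0 : P), Pi.single (Fin.last (m + 1)) Ω) =
      fderiv ℝ G (y, θ, CJet.trunc ι m J)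
        ((0 : E), (0 : P), Pi.single (Fin.last m) (fun I : Fin m → ι => Ω (Fin.snoc I i₀))) := by
  have ht : IsOpen {x : E × P × CJet ι m | (x.1, x.2.1) ∈ s} :=
    hs.preimage (continuous_fst.prodMk (continuous_fst.comp continuous_snd))
  -- `TD i₀ G = x ↦ DG(A x) (B x)` with `A` linear and `B` affine
  let A : (E × P × CJet ι (m + 1)) →L[ℝ] (E × P × CJet ι m) :=
    (ContinuousLinearMap.fst ℝ E (P × CJet ι (m + 1))).prod
      (((ContinuousLinearMap.fst ℝ P (CJet ι (m + 1))).comp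
        (ContinuousLinearMap.snd ℝ E (P × CJet ι (m + 1)))).prod
        ((CJet.trunc ι m).comp ((ContinuousLinearMap.snd ℝ P (CJet ι (m + 1))).comp
          (ContinuousLinearMap.snd ℝ E (P × CJet ι (m + 1))))))
  let B : (E × P × CJet ι (m + 1)) →L[ℝ] (E × P × CJet ι m) :=
    (0 : (E × P × CJet ι (m + 1)) →L[ℝ] E).prod
      ((0 : (E × P × CJet ι (m + 1)) →L[ℝ] P).prod
        ((CJet.ins ι m i₀).comp ((ContinuousLinearMap.snd ℝ P (CJet ι (m + 1))).comp
          (ContinuousLinearMap.snd ℝ E (P × CJet ι (m + 1))))))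
  have hGd : ContDiffOn ℝ ∞ (fderiv ℝ G) {x : E × P × CJet ι m | (x.1, x.2.1) ∈ s} :=
    hG.fderiv_of_isOpen ht (le_of_eq rfl)
  have hdiff : DifferentiableAt ℝ (fderiv ℝ G) (y, θ, CJet.trunc ι m J) :=
    (hGd.differentiableOn (by simp)).differentiableAt (ht.mem_nhds hy)
  have hc : HasFDerivAt (fun x : E × P × CJet ι (m + 1) =>
      fderiv ℝ G (x.1, x.2.1, CJet.trunc ι m x.2.2))
      ((fderiv ℝ (fderiv ℝ G) (y, θ, CJet.trunc ι m J)).comp A) (y, θ, J) := by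
    have hA : HasFDerivAt (fun x : E × P × CJet ι (m + 1) =>
        (x.1, x.2.1, CJet.trunc ι m x.2.2)) A (y, θ, J) := A.hasFDerivAt
    have h := @HasFDerivAt.comp ℝ _ (E × P × CJet ι (m + 1)) _ _ (E × P × CJet ι m) _ _
      (E × P × CJet ι m →L[ℝ] ℝ) _ _ (fun x => (x.1, x.2.1, CJet.trunc ι m x.2.2)) A (y, θ, J)
      (fderiv ℝ G) (fderiv ℝ (fderiv ℝ G) (y, θ, CJet.trunc ι m J)) hdiff.hasFDerivAt hA
    exact h
  have hB : HasFDerivAt (fun x : E × P × CJet ι (m + 1) =>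
      ((bE i₀ : E), (0 : P), CJet.ins ι m i₀ x.2.2)) B (y, θ, J) :=
    (hasFDerivAt_const _ _).prodMk ((hasFDerivAt_const _ _).prodMk
      (((CJet.ins ι m i₀).comp ((ContinuousLinearMap.snd ℝ P (CJet ι (m + 1))).comp
          (ContinuousLinearMap.snd ℝ E (P × CJet ι (m + 1))))).hasFDerivAt))
  have hTD : HasFDerivAt (TD bE m i₀ G) _ (y, θ, J) := hc.clm_apply hB
  rw [hTD.fderiv]
  -- the `A`-part vanishes since `trunc` kills the top slot; the `B`-part is `ins_single_last`
  simp only [add_apply, ContinuousLinearMap.comp_apply,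
    ContinuousLinearMap.flip_apply, A, B, ContinuousLinearMap.prod_apply,
    zero_apply, ContinuousLinearMap.coe_fst', ContinuousLinearMap.coe_snd',
    CJet.trunc_single_last, CJet.ins_single_last, Prod.mk_zero_zero, map_zero, add_zero]

/-- **Splitting off the top-order part**: `TD i₀ G (y,θ,J') = ∂_top G[ins-top] + (the rest)`,
the rest being `DG(y,θ,trunc J')` applied to the vector with the top jet slot removed (pure
linearity of `DG(y, θ, trunc J')`). [folklore] -/
theorem TD_eq_symbol_add (bE : OrthonormalBasis ι ℝ E) [DecidableEq ι] {m : ℕ}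
    (G : E × P × CJet ι m → ℝ) (i₀ : ι) (y : E) (θ : P) (J : CJet ι (m + 1)) :
    TD bE m i₀ G (y, θ, J) =
      fderiv ℝ G (y, θ, CJet.trunc ι m J)
          ((0 : E), (0 : P), Pi.single (Fin.last m)
            (fun I : Fin m → ι => J (Fin.last (m + 1)) (Fin.snoc I i₀))) +
        fderiv ℝ G (y, θ, CJet.trunc ι m J)
          (bE i₀, (0 : P), CJet.ins ι m i₀ J - Pi.single (Fin.last m)
            (fun I : Fin m → ι => J (Fin.last (m + 1)) (Fin.snoc I i₀))) := by
  rw [← map_add, Prod.mk_add_mk, Prod.mk_add_mk, zero_add, zero_add, add_sub_cancel]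
  rfl

end Literature.Analysis.Calculus
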